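import Literature.MathematicalPhysics.QuantumLattice.LiebRobinsonFnwGapCrossProofs
import HarnessLib

/-!
# The overlap of the MPS projections of two overlapping intervals (FNW Lemma 6.2)

Sibling proof file of `Literature/MathematicalPhysics/QuantumLattice/LiebRobinson.lean`
(theorem-only: no definition, no named fact), a step towards the discharge of
`fannes_nachtergaele_werner_gap` (**hubbard.S16**; Fannes–Nachtergaele–Werner 1992, Thm. 6.4),
continuing `LiebRobinsonFnwGapCrossProofs.lean`.

* `fnw_overlap_le` — **FNW Lemma 6.2 in the normalised gauge, bilinear form**: on three
  consecutive intervals of lengths `a, b, c`, for `Φ ∈ 𝒢_{a+b} ⊗ ℋ^{⊗c}` and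
  `Ψ ∈ ℋ^{⊗a} ⊗ 𝒢_{b+c}` both orthogonal to `𝒢_{a+b+c}` (given through their boundary families and
  tested against the vectors `w ↦ tr (X A^{w})`), `|⟨Φ, Ψ⟩| ≤ ε ‖Φ‖ ‖Ψ‖` with
  `ε = (2/λ) (δ D² λ^{-1/2} + δ² D⁴ λ^{-5/2})`, where `δ` bounds the entries of
  `𝔼ⁿ(e_a e_dᵀ) - ρ_{da} 𝟙` at the lengths `n = b, a+b, b+c` and `δ D² ≤ λ/2`. This is
  `‖(G_{ℓ+m} ⊗ 𝟙_r)(𝟙_ℓ ⊗ G_{m+r}) - G_{ℓ+m+r}‖ → 0` (`m → ∞`, uniformly in `ℓ, r`).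

Proof as printed (FNW p. 476–477): `⟨Φ, Ψ⟩ = tr (Θ Δ) + E` (`norm_cross_sub_trace_le`);
orthogonality to `𝒢_{a+b+c}` tested on `tr (X A^{w})` makes `Θ` (with `C_u := X A^{u}`) and `Δ`
(with `B_t := A^{t} X`) small, `‖Θ‖₂ ≲ δ ‖Φ‖`, `‖Δ‖₂ ≲ δ ‖Ψ‖`; and `‖Φ‖, ‖Ψ‖` dominate their boundary
families (`mul_sum_norm_sq_le_sum_norm_trace_sq`).

## Source

* M. Fannes, B. Nachtergaele, R. F. Werner, Comm. Math. Phys. **144** (1992) 443–490, §6,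
  Lemma 6.2 (p. 476: "For all `ℓ, m, r ∈ ℕ` with `m ≥ ℓ₀` …
  `‖(G_{ℓ+m} ⊗ 𝟙_r)(𝟙_ℓ ⊗ G_{m+r}) - G_{ℓ+m+r}‖ ≤ …`") and its proof (p. 476–477).
  [FannesNachtergaeleWernerCMP1992]
-/

noncomputable section

open Matrix
open scoped ComplexOrder MatrixOrder

namespace Literature.MathematicalPhysics.QuantumLattice

section QLattice

variable {q D : ℕ}

/-- **The overlap estimate (Fannes–Nachtergaele–Werner 1992, Lemma 6.2) in the normalised gauge.**
On three consecutive intervals of lengths `a, b, c`, let `Φ` be a vector all of whose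
`(a+b)`-prefix slices are boundary MPS (`Φ ∈ 𝒢_{a+b} ⊗ ℋ^{⊗c}`) and `Ψ` one all of whose
`(b+c)`-suffix slices are boundary MPS (`Ψ ∈ ℋ^{⊗a} ⊗ 𝒢_{b+c}`), both orthogonal to `𝒢_{a+b+c}`
(the vectors `w ↦ tr (X A^{w})`). If the transfer operator iterates at the lengths `b`, `a + b`,
`b + c` are within `δ` (entrywise, `δ D² ≤ λ/2`) of their limit `X ↦ tr (ρ X) 𝟙`, then
`|⟨Φ, Ψ⟩| ≤ ε ‖Φ‖ ‖Ψ‖` with `ε = (2/λ) (δ D² λ^{-1/2} + δ² D⁴ λ^{-5/2})`, which tends to `0` with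
`δ`; in FNW's notation this is `‖(G_{ℓ+m} ⊗ 𝟙_r)(𝟙_ℓ ⊗ G_{m+r}) - G_{ℓ+m+r}‖ ≤ O(a(m))`. Proof as
printed (FNW pp. 476–477): write the pairing through the middle Gram sums
(`norm_cross_sub_trace_le`): `⟨Φ, Ψ⟩ = tr (Θ Δ) + E`; orthogonality to `𝒢_{a+b+c}`, tested on the
vectors `tr (X A^{w})`, makes `Θ` and `Δ` small (`‖Θ‖₂ ≲ δ ‖Φ‖`, `‖Δ‖₂ ≲ δ ‖Ψ‖`), and the norms of
`Φ`, `Ψ` dominate those of their boundary families (`mul_sum_norm_sq_le_sum_norm_trace_sq`).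
[cite: FannesNachtergaeleWernerCMP1992, Lemma 6.2] -/
theorem fnw_overlap_le (A : MPSTensor q D) {ρ : Matrix (Fin D) (Fin D) ℂ}
    (h1 : transferOp A 1 = 1) (hρ : transferOp (fun i => (A i)ᴴ) ρ = ρ)
    (hρ1 : (1 - ρ).PosSemidef) {lam : ℝ} (hlam : 0 < lam)
    (hlamρ : (ρ - (lam : ℂ) • (1 : Matrix (Fin D) (Fin D) ℂ)).PosSemidef)
    {a b c : ℕ} {δ : ℝ} (hδ0 : 0 ≤ δ) (hδlam : δ * (D : ℝ) ^ 2 ≤ lam / 2)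
    (hδb : ∀ a' d' i j : Fin D, ‖((transferOp A ^ b) (Matrix.single a' d' 1) -
      ρ d' a' • (1 : Matrix (Fin D) (Fin D) ℂ)) i j‖ ≤ δ)
    (hδab : ∀ a' d' i j : Fin D, ‖((transferOp A ^ (a + b)) (Matrix.single a' d' 1) -
      ρ d' a' • (1 : Matrix (Fin D) (Fin D) ℂ)) i j‖ ≤ δ)
    (hδbc : ∀ a' d' i j : Fin D, ‖((transferOp A ^ (b + c)) (Matrix.single a' d' 1) -
      ρ d' a' • (1 : Matrix (Fin D) (Fin D) ℂ)) i j‖ ≤ δ)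
    (Φ Ψ : (Fin a → Fin q) → (Fin b → Fin q) → (Fin c → Fin q) → ℂ)
    (hΦ : ∀ t, ∃ B : Matrix (Fin D) (Fin D) ℂ, ∀ u s,
      Φ u s t = (B * wordProduct A u * wordProduct A s).trace)
    (hΨ : ∀ u, ∃ C : Matrix (Fin D) (Fin D) ℂ, ∀ s t,
      Ψ u s t = (C * wordProduct A s * wordProduct A t).trace)
    (hΦperp : ∀ X : Matrix (Fin D) (Fin D) ℂ, ∑ u, ∑ s, ∑ t,
      star ((X * wordProduct A u * wordProduct A s * wordProduct A t).trace) * Φ u s t = 0)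
    (hΨperp : ∀ X : Matrix (Fin D) (Fin D) ℂ, ∑ u, ∑ s, ∑ t,
      star ((X * wordProduct A u * wordProduct A s * wordProduct A t).trace) * Ψ u s t = 0) :
    ‖∑ u, ∑ s, ∑ t, star (Φ u s t) * Ψ u s t‖ ≤
      (2 / lam) * (δ * (D : ℝ) ^ 2 * Real.sqrt lam⁻¹ +
          (δ * (D : ℝ) ^ 2) ^ 2 * lam⁻¹ ^ 2 * Real.sqrt lam⁻¹) *
        Real.sqrt (∑ u, ∑ s, ∑ t, ‖Φ u s t‖ ^ 2) * Real.sqrt (∑ u, ∑ s, ∑ t, ‖Ψ u s t‖ ^ 2) := by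
  choose B hB using hΦ
  choose C hC using hΨ
  -- notation
  set K₁ : ℝ := δ * (D : ℝ) ^ 2 with hK₁
  have hK₁0 : 0 ≤ K₁ := by positivity
  set SB : ℝ := ∑ t, ∑ i, ∑ j, ‖B t i j‖ ^ 2 with hSB
  set SC : ℝ := ∑ u, ∑ i, ∑ j, ‖C u i j‖ ^ 2 with hSC
  have hSB0 : 0 ≤ SB := by positivity
  have hSC0 : 0 ≤ SC := by positivity
  set Θ : Matrix (Fin D) (Fin D) ℂ := ∑ t : Fin c → Fin q, (B t)ᴴ * ρ * wordProduct A t with hΘ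
  set Δ : Matrix (Fin D) (Fin D) ℂ := ∑ u : Fin a → Fin q, C u * (wordProduct A u)ᴴ with hΔ
  have hlinv : 0 ≤ lam⁻¹ := inv_nonneg.2 hlam.le
  -- (1) the pairing in family form, and the cross decomposition
  have hpair : ∑ u, ∑ s, ∑ t, star (Φ u s t) * Ψ u s t =
      ∑ u : Fin a → Fin q, ∑ s : Fin b → Fin q, ∑ t : Fin c → Fin q,
        star ((B t * wordProduct A u * wordProduct A s).trace) *
          (C u * wordProduct A s * wordProduct A t).trace := by
    simp only [hB, hC]
  have hcross := norm_cross_sub_trace_le A h1 hρ hρ1 hlam hlamρ hδ0 hδb B C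
  rw [← hpair] at hcross
  -- (2) norms of `Φ`, `Ψ` dominate the families
  have hΦnorm : lam / 2 * SB ≤ ∑ u, ∑ s, ∑ t, ‖Φ u s t‖ ^ 2 := by
    conv_rhs => arg 2; ext u; rw [Finset.sum_comm]
    rw [Finset.sum_comm, hSB, Finset.mul_sum]
    refine Finset.sum_le_sum fun t _ => ?_
    have h := mul_sum_norm_sq_le_sum_norm_trace_sq A hlamρ hδ0 hδlam hδab (B t)
    refine h.trans (le_of_eq ?_)
    rw [← sum_sum_eq_sum_append]
    refine Finset.sum_congr rfl fun u _ => Finset.sum_congr rfl fun s _ => ?_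
    rw [hB, wordProduct_append, Matrix.mul_assoc]
  have hΨnorm : lam / 2 * SC ≤ ∑ u, ∑ s, ∑ t, ‖Ψ u s t‖ ^ 2 := by
    rw [hSC, Finset.mul_sum]
    refine Finset.sum_le_sum fun u _ => ?_
    have h := mul_sum_norm_sq_le_sum_norm_trace_sq A hlamρ hδ0 hδlam hδbc (C u)
    refine h.trans (le_of_eq ?_)
    rw [← sum_sum_eq_sum_append]
    refine Finset.sum_congr rfl fun s _ => Finset.sum_congr rfl fun t _ => ?_
    rw [hC, wordProduct_append, Matrix.mul_assoc]
  -- (3) `Θ` is small: test `hΦperp` on `C_u := X A^u`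
  have hΘX : ∀ X : Matrix (Fin D) (Fin D) ℂ,
      ‖(Θ * X).trace‖ ≤ K₁ * Real.sqrt (lam⁻¹ * ∑ i, ∑ j, ‖X i j‖ ^ 2) * Real.sqrt SB := by
    intro X
    -- the triple sum vanishes by orthogonality of `Φ`
    have h0 : ∑ u : Fin a → Fin q, ∑ s : Fin b → Fin q, ∑ t : Fin c → Fin q,
        star ((B t * wordProduct A u * wordProduct A s).trace) *
          (X * wordProduct A u * wordProduct A s * wordProduct A t).trace = 0 := by
      have h2 := congrArg star (hΦperp X)
      rw [star_zero, star_sum] at h2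
      rw [← h2]
      refine Finset.sum_congr rfl fun u _ => ?_
      rw [star_sum]
      refine Finset.sum_congr rfl fun s _ => ?_
      rw [star_sum]
      refine Finset.sum_congr rfl fun t _ => ?_
      rw [star_mul', star_star, hB, mul_comm]
    -- `Δ_X = X`
    have hΔX : ∑ u : Fin a → Fin q, X * wordProduct A u * (wordProduct A u)ᴴ = X := by
      rw [show (∑ u : Fin a → Fin q, X * wordProduct A u * (wordProduct A u)ᴴ) =
          ∑ u : Fin a → Fin q, X * (wordProduct A u * (wordProduct A u)ᴴ) from
        Finset.sum_congr rfl fun u _ => Matrix.mul_assoc _ _ _,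
        ← Finset.mul_sum, sum_wordProduct_mul_conjTranspose A h1 a, Matrix.mul_one]
    -- `Σ_u |X A^u|² = |X|²`
    have hXnorm : ∑ u : Fin a → Fin q, ∑ i, ∑ j, ‖(X * wordProduct A u) i j‖ ^ 2 =
        ∑ i, ∑ j, ‖X i j‖ ^ 2 := sum_sum_norm_sq_mul_wordProduct A h1 a X
    have h := norm_cross_sub_trace_le A h1 hρ hρ1 hlam hlamρ hδ0 hδb B
      (fun u : Fin a → Fin q => X * wordProduct A u)
    beta_reduce at h
    rw [h0, zero_sub, norm_neg, hΔX, hXnorm] at h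
    exact h
  have hΘsmall : Real.sqrt (∑ i, ∑ j, ‖Θᴴ i j‖ ^ 2) ≤ K₁ * Real.sqrt lam⁻¹ * Real.sqrt SB := by
    have h := hΘX Θᴴ
    have e1 : (Θ * Θᴴ).trace = ((∑ i, ∑ j, ‖Θᴴ i j‖ ^ 2 : ℝ) : ℂ) := by
      have := trace_conjTranspose_mul_self_eq Θᴴ
      rwa [conjTranspose_conjTranspose] at this
    rw [e1, Complex.norm_real, Real.norm_of_nonneg (by positivity), Real.sqrt_mul hlinv] at h
    refine sqrt_le_of_le_mul_sqrt (by positivity) ?_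
    calc ∑ i, ∑ j, ‖Θᴴ i j‖ ^ 2
        ≤ K₁ * (Real.sqrt lam⁻¹ * Real.sqrt (∑ i, ∑ j, ‖Θᴴ i j‖ ^ 2)) * Real.sqrt SB := h
      _ = K₁ * Real.sqrt lam⁻¹ * Real.sqrt SB * Real.sqrt (∑ i, ∑ j, ‖Θᴴ i j‖ ^ 2) := by ring
  -- (4) `Δ` is small: test `hΨperp` on `B_t := A^t X`
  have hΔX : ∀ X : Matrix (Fin D) (Fin D) ℂ,
      ‖(Xᴴ * ρ * Δ).trace‖ ≤ K₁ * lam⁻¹ * Real.sqrt SC * Real.sqrt (∑ i, ∑ j, ‖X i j‖ ^ 2) := by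
    intro X
    have e3 : ∀ (u : Fin a → Fin q) (s : Fin b → Fin q) (t : Fin c → Fin q),
        (wordProduct A t * X * wordProduct A u * wordProduct A s).trace =
          (X * wordProduct A u * wordProduct A s * wordProduct A t).trace := by
      intro u s t
      rw [Matrix.mul_assoc, Matrix.mul_assoc, trace_mul_comm, ← Matrix.mul_assoc]
    have h0 : ∑ u : Fin a → Fin q, ∑ s : Fin b → Fin q, ∑ t : Fin c → Fin q,
        star ((wordProduct A t * X * wordProduct A u * wordProduct A s).trace) *
          (C u * wordProduct A s * wordProduct A t).trace = 0 := by
      rw [← hΨperp X]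
      refine Finset.sum_congr rfl fun u _ => Finset.sum_congr rfl fun s _ =>
        Finset.sum_congr rfl fun t _ => ?_
      rw [hC, e3]
    -- `Θ_X = Xᴴ ρ`
    have hΘX' : ∑ t : Fin c → Fin q, (wordProduct A t * X)ᴴ * ρ * wordProduct A t = Xᴴ * ρ := by
      have e : ∀ t : Fin c → Fin q, (wordProduct A t * X)ᴴ * ρ * wordProduct A t =
          Xᴴ * ((wordProduct A t)ᴴ * ρ * wordProduct A t) := by
        intro t; rw [conjTranspose_mul]; simp only [Matrix.mul_assoc]
      simp only [e, ← Finset.mul_sum, sum_conjTranspose_wordProduct_mul_mul,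
        pow_apply_of_apply_eq _ hρ]
    have hXnorm : ∑ t : Fin c → Fin q, ∑ i, ∑ j, ‖(wordProduct A t * X) i j‖ ^ 2 ≤
        lam⁻¹ * ∑ i, ∑ j, ‖X i j‖ ^ 2 := sum_sum_norm_sq_wordProduct_mul_le A hρ hρ1 hlam hlamρ c X
    have h := norm_cross_sub_trace_le A h1 hρ hρ1 hlam hlamρ hδ0 hδb
      (fun t : Fin c → Fin q => wordProduct A t * X) C
    beta_reduce at h
    rw [h0, zero_sub, norm_neg, hΘX'] at h
    calc ‖(Xᴴ * ρ * Δ).trace‖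
        ≤ K₁ * Real.sqrt (lam⁻¹ * SC) *
            Real.sqrt (∑ t : Fin c → Fin q, ∑ i, ∑ j, ‖(wordProduct A t * X) i j‖ ^ 2) := h
      _ ≤ K₁ * Real.sqrt (lam⁻¹ * SC) * Real.sqrt (lam⁻¹ * ∑ i, ∑ j, ‖X i j‖ ^ 2) :=
          mul_le_mul_of_nonneg_left (Real.sqrt_le_sqrt hXnorm) (by positivity)
      _ = K₁ * lam⁻¹ * Real.sqrt SC * Real.sqrt (∑ i, ∑ j, ‖X i j‖ ^ 2) := by
          rw [Real.sqrt_mul hlinv, Real.sqrt_mul hlinv]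
          have : Real.sqrt lam⁻¹ * Real.sqrt lam⁻¹ = lam⁻¹ := Real.mul_self_sqrt hlinv
          calc K₁ * (Real.sqrt lam⁻¹ * Real.sqrt SC) * (Real.sqrt lam⁻¹ * Real.sqrt (∑ i, ∑ j, ‖X i j‖ ^ 2))
              = K₁ * (Real.sqrt lam⁻¹ * Real.sqrt lam⁻¹) * Real.sqrt SC *
                  Real.sqrt (∑ i, ∑ j, ‖X i j‖ ^ 2) := by ring
            _ = _ := by rw [this]
  have hΔsmall : Real.sqrt (∑ i, ∑ j, ‖Δ i j‖ ^ 2) ≤ K₁ * lam⁻¹ ^ 2 * Real.sqrt SC := by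
    have h := hΔX Δ
    have hlow := mul_sum_norm_sq_le_re_trace hlamρ Δ
    have h2 : lam * ∑ i, ∑ j, ‖Δ i j‖ ^ 2 ≤
        K₁ * lam⁻¹ * Real.sqrt SC * Real.sqrt (∑ i, ∑ j, ‖Δ i j‖ ^ 2) :=
      hlow.trans ((Complex.re_le_norm _).trans h)
    refine sqrt_le_of_le_mul_sqrt (by positivity) ?_
    have h3 := mul_le_mul_of_nonneg_left h2 hlinv
    rw [← mul_assoc, inv_mul_cancel₀ hlam.ne', one_mul] at h3
    calc ∑ i, ∑ j, ‖Δ i j‖ ^ 2 ≤ lam⁻¹ * (K₁ * lam⁻¹ * Real.sqrt SC * Real.sqrt (∑ i, ∑ j, ‖Δ i j‖ ^ 2)) := h3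
      _ = K₁ * lam⁻¹ ^ 2 * Real.sqrt SC * Real.sqrt (∑ i, ∑ j, ‖Δ i j‖ ^ 2) := by ring
  -- (5) the main term
  have hmainle : ‖(Θ * Δ).trace‖ ≤ (K₁ * Real.sqrt lam⁻¹ * Real.sqrt SB) *
      (K₁ * lam⁻¹ ^ 2 * Real.sqrt SC) := by
    refine (norm_trace_mul_le_sqrt_sum_mul_sqrt_sum Θ Δ).trans ?_
    rw [← sum_sum_norm_sq_conjTranspose Θ]
    exact mul_le_mul hΘsmall hΔsmall (Real.sqrt_nonneg _) (by positivity)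
  -- (6) assemble
  have hsqB : Real.sqrt SB ≤ Real.sqrt (2 / lam) * Real.sqrt (∑ u, ∑ s, ∑ t, ‖Φ u s t‖ ^ 2) := by
    rw [← Real.sqrt_mul (by positivity)]
    refine Real.sqrt_le_sqrt ?_
    have := mul_le_mul_of_nonneg_left hΦnorm (by positivity : (0 : ℝ) ≤ 2 / lam)
    rwa [← mul_assoc, show 2 / lam * (lam / 2) = 1 by field_simp, one_mul] at this
  have hsqC : Real.sqrt SC ≤ Real.sqrt (2 / lam) * Real.sqrt (∑ u, ∑ s, ∑ t, ‖Ψ u s t‖ ^ 2) := by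
    rw [← Real.sqrt_mul (by positivity)]
    refine Real.sqrt_le_sqrt ?_
    have := mul_le_mul_of_nonneg_left hΨnorm (by positivity : (0 : ℝ) ≤ 2 / lam)
    rwa [← mul_assoc, show 2 / lam * (lam / 2) = 1 by field_simp, one_mul] at this
  have htwo : Real.sqrt (2 / lam) * Real.sqrt (2 / lam) = 2 / lam :=
    Real.mul_self_sqrt (by positivity)
  set NΦ := Real.sqrt (∑ u, ∑ s, ∑ t, ‖Φ u s t‖ ^ 2) with hNΦ
  set NΨ := Real.sqrt (∑ u, ∑ s, ∑ t, ‖Ψ u s t‖ ^ 2) with hNΨ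
  have hprod : Real.sqrt SB * Real.sqrt SC ≤ 2 / lam * (NΦ * NΨ) := by
    calc Real.sqrt SB * Real.sqrt SC
        ≤ (Real.sqrt (2 / lam) * NΦ) * (Real.sqrt (2 / lam) * NΨ) :=
          mul_le_mul hsqB hsqC (Real.sqrt_nonneg _) (by positivity)
      _ = Real.sqrt (2 / lam) * Real.sqrt (2 / lam) * (NΦ * NΨ) := by ring
      _ = 2 / lam * (NΦ * NΨ) := by rw [htwo]
  calc ‖∑ u, ∑ s, ∑ t, star (Φ u s t) * Ψ u s t‖
      ≤ ‖(Θ * Δ).trace‖ + ‖(∑ u, ∑ s, ∑ t, star (Φ u s t) * Ψ u s t) - (Θ * Δ).trace‖ :=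
        norm_le_insert' _ _
    _ ≤ (K₁ * Real.sqrt lam⁻¹ * Real.sqrt SB) * (K₁ * lam⁻¹ ^ 2 * Real.sqrt SC) +
          K₁ * Real.sqrt (lam⁻¹ * SC) * Real.sqrt SB := add_le_add hmainle hcross
    _ = (K₁ * Real.sqrt lam⁻¹ + K₁ ^ 2 * lam⁻¹ ^ 2 * Real.sqrt lam⁻¹) *
          (Real.sqrt SB * Real.sqrt SC) := by
        rw [Real.sqrt_mul hlinv]; ring
    _ ≤ (K₁ * Real.sqrt lam⁻¹ + K₁ ^ 2 * lam⁻¹ ^ 2 * Real.sqrt lam⁻¹) * (2 / lam * (NΦ * NΨ)) :=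
        mul_le_mul_of_nonneg_left hprod (by positivity)
    _ = _ := by rw [hK₁]; ring

end QLattice

end Literature.MathematicalPhysics.QuantumLattice
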